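import Summits.Ventures.LatticeQCDFlow.Scaling.HomStarStationaryLumping
import Summits.Ventures.LatticeQCDFlow.Scaling.HomStarFloor

/-!
HONEST FRAMING: exact (Metropolis-corrected) sampling algorithms for lattice gauge theory; figures
of merit are autocorrelation/cost numbers at stated couplings and volumes; no continuum-physics
claim.

# HomStarCrowdedMass — THE HALF-MASS HYPOTHESIS OF THE FLOOR FOR ASYMMETRIC LAWS: `π_S{fewer than m particles off u} ≤ (μ_0(u) + K·μ_1(u))/(K+1−m)` (lean-2 GEN-44, ours)

Venture-side (OURS).  Cell `lqcd-flow` (pub-lqcd), unit `pub-lqcd-lean-2-g44`, 2026-08-31.  Chapter AD, file 16.  The floor of files 6∕11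
(`d(n) ≥ 1 − min{…}/m − π_S{fewer than m particles off u}`) and the mixing-time floor of file 6 need the crowded compositions to carry at most
half of `π_S`; file 7 discharged this for SYMMETRIC content laws.  With file 15's identification `π_S = Λ_*(μ_0 ⊗ μ_1 ⊗ ⋯ ⊗ μ_1)` the crowded
mass is a statement about the product law, and Markov's inequality on the number `N_u = #{k : y_k = u}` of replicas holding `u`
(`E_{⊗μ} N_u = μ_0(u) + K·μ_1(u)` by the one-coordinate marginals of LPW §12.4) gives it for EVERY law:
`π_S{x : (K+1) − comp x(u) < m} ≤ (μ_0(u) + K·μ_1(u))/(K+1−m)` (`m < K+1`); in particular the half-mass hypothesis with `m = (K+1)/2` holds as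
soon as `μ_0(u) + K·μ_1(u) ≤ (K+1)/4` — e.g. whenever `μ_0(u), μ_1(u) ≤ 1/4` — so the two-sided step law of files 3∕6 (and 10∕11 at the scheme
level) is unconditional for every homogeneous star whose cold law puts at most a quarter of its mass on the most persistent content.

* `tensorFun_expect_count` — `Σ_y (⊗μ)(y)·#{k : y_k = u} = Σ_k μ_k(u)`.
* **`homStar_crowded_mass_le`** — the displayed Markov bound for `π_S`.
* **`homStar_crowded_mass_le_half`** — `μ_0(u) + K·μ_1(u) ≤ (K+1)/4 ⇒ π_S{(K+1) − comp x(u) < (K+1)/2} ≤ 1/2` (file 6's `hhalf` with `m = (K+1)/2`).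
* **`homStar_pooled_tvDist_ge_markov`** — file 11's scheme-level floor FOR EVERY LAW: `‖Λ_*(δ_yPⁿ) − π_S‖_TV ≥ 1 − min{n(1−t)w_0, 1+nta}/m − (μ_0(u)+Kμ_1(u))/(K+1−m)`.

Literature grade (cell rule): OWN, elementary on file 15 and the typed [LevinPeres2017, §12.4] marginal lemma; nothing new cited; no new bib keys.
-/

noncomputable section
open Finset Function
open Literature.Probability.MarkovChains

namespace Summit.Ventures.LatticeQCDFlow.Scaling

section CrowdedMass
variable {S : Type*} [Fintype S] [DecidableEq S] {K m : ℕ} {μ : Fin (K + 1) → S → ℝ} {M : Fin (K + 1) → S → S → ℝ} {w : Fin (K + 1) → ℝ} {t : ℝ}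
variable (κ : Fin m → Fin K)
variable {X : Type*} [Fintype X] [DecidableEq X] {hub : X → S} {comp : X → S → ℕ} {W : S → ℝ} {acc : S → S → ℝ} {Kh : (S → ℕ) → S → S → ℝ}
variable {Ast Bst Sl : X → X → ℝ} {g : (S → ℕ) → ℝ} {πS : X → ℝ} {Z : ℝ}
variable {Λ : (Fin (K + 1) → S) → X}

omit κ in
/-- The expected number of replicas holding `u` under the product law is the sum of the one-coordinate masses at `u`. [ours] -/
theorem tensorFun_expect_count (hμsum : ∀ k, ∑ v, μ k v = 1) (u : S) :
    ∑ y : Fin (K + 1) → S, tensorFun μ y * (((univ.filter fun k : Fin (K + 1) => y k = u).card : ℕ) : ℝ) = ∑ k, μ k u := by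
  classical
  have hcard : ∀ y : Fin (K + 1) → S, (((univ.filter fun k : Fin (K + 1) => y k = u).card : ℕ) : ℝ) = ∑ k, (if y k = u then (1 : ℝ) else 0) := by
    intro y; rw [Finset.card_filter]; push_cast; rfl
  simp_rw [hcard, mul_sum]
  rw [sum_comm]
  refine sum_congr rfl fun k _ => ?_
  rw [sum_tensorFun_mul_apply μ hμsum k (fun v => if v = u then (1 : ℝ) else 0)]
  simp_rw [mul_ite, mul_one, mul_zero]
  rw [Finset.sum_ite_eq' univ u, if_pos (mem_univ _)]

/-- **Markov bound for the crowded mass, every law:** `π_S{x : (K+1) − comp x(u) < m} ≤ (μ_0(u) + K·μ_1(u))/(K+1−m)` for `m < K+1`. [ours] -/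
theorem homStar_crowded_mass_le [Nonempty X] (hm : 1 ≤ m) (hμ : ∀ k x, 0 < μ k x) (hμsum : ∀ k, ∑ u, μ k u = 1)
    (hhom : ∀ i : Fin K, μ i.succ = μ 1) (hw0 : ∀ k, 0 ≤ w k) (hw00 : 0 < w 0) (hw1 : ∑ k, w k = 1) (ht0 : 0 < t) (ht1 : t < 1)
    (hM0 : ∀ u v, M 0 u v = μ 0 v) (hidle : ∀ i : Fin K, ∀ u v, M i.succ u v = if v = u then 1 else 0)
    {c : ℕ} (hunif : ∀ i : Fin K, (univ.filter fun r : Fin m => κ r = i).card = c)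
    (hWdef : ∀ v, W v = μ 1 v / μ 0 v) (hinj : ∀ x x', hub x = hub x' → comp x = comp x' → x = x') (hsum : ∀ x, ∑ v, comp x v = K + 1)
    (hsurj : ∀ (z : S) (N : S → ℕ), ∑ v, N v = K + 1 → N z ≠ 0 → ∃ x, hub x = z ∧ comp x = N) (hhub : ∀ x, comp x (hub x) ≠ 0) (hK : 1 ≤ K)
    (hacc : ∀ h v, acc h v = min 1 (W h / W v))
    (hKoff : ∀ N h v, h ≠ v → Kh N h v = if N h = 0 then 0 else (N v : ℝ) / K * acc h v) (hKdiag : ∀ N h, Kh N h h = 1 - ∑ v ∈ univ.erase h, Kh N h v)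
    (hA : ∀ x x', Ast x x' = if comp x' = comp x then Kh (comp x) (hub x) (hub x') else 0)
    (hB : ∀ x x', Bst x x' = μ 0 (hub x') * (if comp x' + Pi.single (hub x) 1 = comp x + Pi.single (hub x') 1 then 1 else 0))
    (hSl : ∀ x x', Sl x x' = t * Ast x x' + (1 - t) * (w 0 * Bst x x' + (1 - w 0) * (if x = x' then 1 else 0)))
    (hg : ∀ N, g N = ∏ v, (μ 0 v * W v) ^ (N v) / ((N v).factorial : ℝ))
    (hZ : Z = ∑ x, g (comp x) * ((comp x (hub x) : ℝ) / W (hub x))) (hπS : ∀ x, πS x = g (comp x) * ((comp x (hub x) : ℝ) / W (hub x)) / Z)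
    (hΛh : ∀ y, hub (Λ y) = y 0) (hΛc : ∀ y v, comp (Λ y) v = (univ.filter fun k : Fin (K + 1) => y k = v).card)
    (u : S) {m' : ℝ} (hm' : m' < (K : ℝ) + 1) :
    ∑ x ∈ univ.filter (fun x => ((K : ℝ) + 1) - (comp x u : ℝ) < m'), πS x ≤ (μ 0 u + K * μ 1 u) / ((K : ℝ) + 1 - m') := by
  classical
  have hπ : ∀ x, πS x = ∑ y ∈ univ.filter (fun y => Λ y = x), tensorFun μ y := fun x =>
    homStar_piS_eq_pushforward κ hm hμ hμsum hhom hw0 hw00 hw1 ht0 ht1 hM0 hidle hunif hWdef hinj hsum hsurj hhub hK hacc hKoff hKdiag hA hB hSl hg hZ hπS hΛh hΛc x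
  have hden : 0 < (K : ℝ) + 1 - m' := by linarith
  have htf0 : ∀ y, 0 ≤ tensorFun μ y := fun y => (tensorFun_pos hμ y).le
  -- the crowded mass as a product-law expectation of an indicator
  have h1 : ∑ x ∈ univ.filter (fun x => ((K : ℝ) + 1) - (comp x u : ℝ) < m'), πS x
      = ∑ y : Fin (K + 1) → S, tensorFun μ y * (if ((K : ℝ) + 1) - (comp (Λ y) u : ℝ) < m' then (1 : ℝ) else 0) := by
    rw [pushforward_sum_mul (tensorFun μ) (fun x => if ((K : ℝ) + 1) - (comp x u : ℝ) < m' then (1 : ℝ) else 0), Finset.sum_filter]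
    refine sum_congr rfl fun x _ => ?_
    rw [hπ x]; split_ifs <;> simp
  -- Markov: the indicator is at most `N_u/(K+1−m')`
  have h2 : ∀ y : Fin (K + 1) → S, (if ((K : ℝ) + 1) - (comp (Λ y) u : ℝ) < m' then (1 : ℝ) else 0)
      ≤ (((univ.filter fun k : Fin (K + 1) => y k = u).card : ℕ) : ℝ) / ((K : ℝ) + 1 - m') := by
    intro y
    rw [← hΛc y u]
    split_ifs with h
    · rw [le_div_iff₀ hden]; linarith
    · positivity
  rw [h1]
  calc ∑ y : Fin (K + 1) → S, tensorFun μ y * (if ((K : ℝ) + 1) - (comp (Λ y) u : ℝ) < m' then (1 : ℝ) else 0)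
      ≤ ∑ y : Fin (K + 1) → S, tensorFun μ y * ((((univ.filter fun k : Fin (K + 1) => y k = u).card : ℕ) : ℝ) / ((K : ℝ) + 1 - m')) :=
        sum_le_sum fun y _ => mul_le_mul_of_nonneg_left (h2 y) (htf0 y)
    _ = (∑ y : Fin (K + 1) → S, tensorFun μ y * (((univ.filter fun k : Fin (K + 1) => y k = u).card : ℕ) : ℝ)) / ((K : ℝ) + 1 - m') := by
        rw [sum_div]; exact sum_congr rfl fun y _ => by ring
    _ = (∑ k, μ k u) / ((K : ℝ) + 1 - m') := by rw [tensorFun_expect_count hμsum u]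
    _ = (μ 0 u + K * μ 1 u) / ((K : ℝ) + 1 - m') := by
        congr 1
        rw [Fin.sum_univ_succ]
        congr 1
        rw [sum_congr rfl fun (i : Fin K) _ => show μ i.succ u = μ 1 u by rw [hhom i], sum_const, card_univ, Fintype.card_fin]
        simp

/-- **The half-mass hypothesis of file 6 for every not-too-concentrated law:** if `μ_0(u) + K·μ_1(u) ≤ (K+1)/4` then the compositions with
fewer than `(K+1)/2` particles off `u` carry at most half of `π_S`. [ours] -/
theorem homStar_crowded_mass_le_half [Nonempty X] (hm : 1 ≤ m) (hμ : ∀ k x, 0 < μ k x) (hμsum : ∀ k, ∑ u, μ k u = 1)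
    (hhom : ∀ i : Fin K, μ i.succ = μ 1) (hw0 : ∀ k, 0 ≤ w k) (hw00 : 0 < w 0) (hw1 : ∑ k, w k = 1) (ht0 : 0 < t) (ht1 : t < 1)
    (hM0 : ∀ u v, M 0 u v = μ 0 v) (hidle : ∀ i : Fin K, ∀ u v, M i.succ u v = if v = u then 1 else 0)
    {c : ℕ} (hunif : ∀ i : Fin K, (univ.filter fun r : Fin m => κ r = i).card = c)
    (hWdef : ∀ v, W v = μ 1 v / μ 0 v) (hinj : ∀ x x', hub x = hub x' → comp x = comp x' → x = x') (hsum : ∀ x, ∑ v, comp x v = K + 1)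
    (hsurj : ∀ (z : S) (N : S → ℕ), ∑ v, N v = K + 1 → N z ≠ 0 → ∃ x, hub x = z ∧ comp x = N) (hhub : ∀ x, comp x (hub x) ≠ 0) (hK : 1 ≤ K)
    (hacc : ∀ h v, acc h v = min 1 (W h / W v))
    (hKoff : ∀ N h v, h ≠ v → Kh N h v = if N h = 0 then 0 else (N v : ℝ) / K * acc h v) (hKdiag : ∀ N h, Kh N h h = 1 - ∑ v ∈ univ.erase h, Kh N h v)
    (hA : ∀ x x', Ast x x' = if comp x' = comp x then Kh (comp x) (hub x) (hub x') else 0)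
    (hB : ∀ x x', Bst x x' = μ 0 (hub x') * (if comp x' + Pi.single (hub x) 1 = comp x + Pi.single (hub x') 1 then 1 else 0))
    (hSl : ∀ x x', Sl x x' = t * Ast x x' + (1 - t) * (w 0 * Bst x x' + (1 - w 0) * (if x = x' then 1 else 0)))
    (hg : ∀ N, g N = ∏ v, (μ 0 v * W v) ^ (N v) / ((N v).factorial : ℝ))
    (hZ : Z = ∑ x, g (comp x) * ((comp x (hub x) : ℝ) / W (hub x))) (hπS : ∀ x, πS x = g (comp x) * ((comp x (hub x) : ℝ) / W (hub x)) / Z)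
    (hΛh : ∀ y, hub (Λ y) = y 0) (hΛc : ∀ y v, comp (Λ y) v = (univ.filter fun k : Fin (K + 1) => y k = v).card)
    (u : S) (hquarter : μ 0 u + K * μ 1 u ≤ ((K : ℝ) + 1) / 4) :
    ∑ x ∈ univ.filter (fun x => ((K : ℝ) + 1) - (comp x u : ℝ) < ((K : ℝ) + 1) / 2), πS x ≤ 1 / 2 := by
  have hK0 : (0 : ℝ) ≤ K := Nat.cast_nonneg _
  have h := homStar_crowded_mass_le κ hm hμ hμsum hhom hw0 hw00 hw1 ht0 ht1 hM0 hidle hunif hWdef hinj hsum hsurj hhub hK hacc hKoff hKdiag hA hB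
    hSl hg hZ hπS hΛh hΛc u (m' := ((K : ℝ) + 1) / 2) (by linarith)
  refine h.trans ?_
  rw [show (K : ℝ) + 1 - ((K : ℝ) + 1) / 2 = ((K : ℝ) + 1) / 2 by ring, div_le_iff₀ (by linarith)]
  linarith


/-- **THE SCHEME-LEVEL FLOOR FOR EVERY LAW:** file 11's floor with its crowded-mass term replaced by the Markov bound of this file — from the all-`u`
configuration, `‖Λ_*(δ_yPⁿ) − π_S‖_TV ≥ 1 − min{n(1−t)w_0, 1+n·t·a}/m − (μ_0(u) + Kμ_1(u))/(K+1−m)` for every `0 < m < K+1` and every `n`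
(`acc(·,u) ≤ a` off `u`). [ours] -/
theorem homStar_pooled_tvDist_ge_markov [Nonempty X] (hm : 1 ≤ m) (hμ : ∀ k x, 0 < μ k x) (hμsum : ∀ k, ∑ u, μ k u = 1)
    (hhom : ∀ i : Fin K, μ i.succ = μ 1) (hw0 : ∀ k, 0 ≤ w k) (hw00 : 0 < w 0) (hw1 : ∑ k, w k = 1) (ht0 : 0 < t) (ht1 : t < 1)
    (hM0 : ∀ u v, M 0 u v = μ 0 v) (hidle : ∀ i : Fin K, ∀ u v, M i.succ u v = if v = u then 1 else 0)
    {c : ℕ} (hunif : ∀ i : Fin K, (univ.filter fun r : Fin m => κ r = i).card = c)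
    (hWdef : ∀ v, W v = μ 1 v / μ 0 v) (hinj : ∀ x x', hub x = hub x' → comp x = comp x' → x = x') (hsum : ∀ x, ∑ v, comp x v = K + 1)
    (hsurj : ∀ (z : S) (N : S → ℕ), ∑ v, N v = K + 1 → N z ≠ 0 → ∃ x, hub x = z ∧ comp x = N) (hhub : ∀ x, comp x (hub x) ≠ 0) (hK : 1 ≤ K)
    (hacc : ∀ h v, acc h v = min 1 (W h / W v))
    (hKoff : ∀ N h v, h ≠ v → Kh N h v = if N h = 0 then 0 else (N v : ℝ) / K * acc h v) (hKdiag : ∀ N h, Kh N h h = 1 - ∑ v ∈ univ.erase h, Kh N h v)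
    (hA : ∀ x x', Ast x x' = if comp x' = comp x then Kh (comp x) (hub x) (hub x') else 0)
    (hB : ∀ x x', Bst x x' = μ 0 (hub x') * (if comp x' + Pi.single (hub x) 1 = comp x + Pi.single (hub x') 1 then 1 else 0))
    (hSl : ∀ x x', Sl x x' = t * Ast x x' + (1 - t) * (w 0 * Bst x x' + (1 - w 0) * (if x = x' then 1 else 0)))
    (hg : ∀ N, g N = ∏ v, (μ 0 v * W v) ^ (N v) / ((N v).factorial : ℝ))
    (hZ : Z = ∑ x, g (comp x) * ((comp x (hub x) : ℝ) / W (hub x))) (hπS : ∀ x, πS x = g (comp x) * ((comp x (hub x) : ℝ) / W (hub x)) / Z)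
    (hΛh : ∀ y, hub (Λ y) = y 0) (hΛc : ∀ y v, comp (Λ y) v = (univ.filter fun k : Fin (K + 1) => y k = v).card)
    (u : S) {a : ℝ} (ha0 : 0 ≤ a) (ha : ∀ h, h ≠ u → acc h u ≤ a) {mm : ℝ} (hmm : 0 < mm) (hmmK : mm < (K : ℝ) + 1) (n : ℕ) :
    1 - min ((n : ℝ) * ((1 - t) * w 0)) (1 + n * (t * a)) / mm - (μ 0 u + K * μ 1 u) / ((K : ℝ) + 1 - mm)
      ≤ tvDist (fun x' => ∑ z ∈ univ.filter (fun z => Λ z = x'),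
          lawAt (fun y z => t * ptGraphSwap μ (fun r : Fin m => (((0 : Fin (K + 1)), (κ r).succ) : Fin (K + 1) × Fin (K + 1))) (fun _ : Fin m => Equiv.refl S) y z
            + (1 - t) * prodKernel w M y z) (Pi.single (fun _ : Fin (K + 1) => u) 1) n z) πS := by
  classical
  have hW : ∀ v, 0 < W v := fun v => by rw [hWdef]; exact div_pos (hμ 1 v) (hμ 0 v)
  have hacc' : ∀ u v, acc u v = min 1 (μ 0 v * μ 1 u / (μ 0 u * μ 1 v)) := by
    intro u v
    rw [hacc, hWdef, hWdef]
    congr 1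
    have h1 := hμ 0 u; have h2 := hμ 0 v; have h3 := hμ 1 u; have h4 := hμ 1 v
    field_simp
  have hπ1 := lumpedStar_piS_sum hhub hW (hμ 0) hg hZ hπS
  have h1 := homStar_pooled_tvDist_ge κ hm hμ hμsum hhom hw0 hw1 ht0.le ht1.le hM0 hidle hunif hinj hsurj hhub hsum hK hacc' hKoff hKdiag hA hB hΛh hΛc
    u ha0 ha hπ1 hmm n
  have h2 := homStar_crowded_mass_le κ hm hμ hμsum hhom hw0 hw00 hw1 ht0 ht1 hM0 hidle hunif hWdef hinj hsum hsurj hhub hK hacc hKoff hKdiag hA hB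
    hSl hg hZ hπS hΛh hΛc u hmmK
  linarith

end CrowdedMass

end Summit.Ventures.LatticeQCDFlow.Scaling

end
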